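import Mathlib.Analysis.Normed.Operator.Compact.FredholmAlternative
import Mathlib.Analysis.Normed.Operator.Compact.Basic
import HarnessLib

/-!
# Fredholm alternative on the fixed subspace of a commuting involution: a symmetric vector is in
  the range of `1 − K` when the kernel is spanned by an antisymmetric vector

Analysis/OperatorTheory file (everything proved, no named facts). Let `X` be a Banach space over a
nontrivially normed field `𝕜` with `2 ≠ 0`, `R : X →L[𝕜] X` a continuous linear map (in applications an
involution, `R ∘ R = 1`, but only `R w = w` / `R φ = −φ` are used), `K : X →L[𝕜] X` compact with
`K ∘ R = R ∘ K`. If the kernel of `T = 1 − K` is spanned by a single vector `φ` with `R φ = −φ`, then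
every `R`-symmetric vector `w` (`R w = w`) lies in the range of `T`
(`symmetric_mem_range_of_antisymmetric_kernel`).

Proof: the fixed subspace `V = {x | R x = x}` (`fixedSubspace R`) is closed and `K`-invariant; the
restriction `K|_V` is compact (`IsCompactOperator.restrict`), so by the Fredholm alternative in Mathlib
(`IsCompactOperator.hasEigenvalue_or_mem_resolventSet`, at `μ = 1`) either `1` is an eigenvalue of
`K|_V` — impossible, a symmetric kernel vector `x = c • φ` of `T` would satisfy `R x = x = −x`, so
`2 x = 0` — or `1 − K|_V` is bijective on `V`, which gives the preimage of `w ∈ V`.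

## Why it is here (source and use)

Standard functional analysis (Fredholm alternative plus a symmetry reduction; no single source —
[folklore]). It is the abstract content of the observation of Jia–Šverák, *J. Funct. Anal.* 268 (2015),
§4 (after (4.6), "important non-generic case"), that their (B)-type non-degeneracy condition
`ℙ(U_{σ₀}·∇U + U·∇U_{σ₀}) ∉ Range(𝓛_{σ₀})` FAILS when the profile branch is invariant under a reflection
and the crossing eigenvector is reflection-antisymmetric (the pitchfork scenario computed numerically by
Guillod–Šverák, *J. Math. Fluid Mech.* 25 (2023), §1, for the datum `a₀ = e^{−4(z/r)²}(r²+z²)^{−1/2} e_θ`).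
The reduction of the unbounded operator `𝓛_{σ₀}` on `X = L²∩L⁴` to `1 − K` with `K = 𝓛⁻¹𝒦(U_{σ₀})`
compact is Jia–Šverák 2015, Lemma 2.1 + Lemma 2.2; it is consumed in
`Literature/Analysis/FluidPDE/JiaSverak2015/Divergence.lean` (`nd1_false_of_reflection`).

## References

* H. Jia, V. Šverák, *Are the incompressible 3d Navier–Stokes equations locally ill-posed in the natural
  energy space?*, J. Funct. Anal. 268 (2015) 3734–3766, §2 Lemmas 2.1–2.2, §4. [JiaSverak2015]
* J. Guillod, V. Šverák, *Numerical investigations of non-uniqueness for the Navier–Stokes initial value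
  problem in borderline spaces*, J. Math. Fluid Mech. 25 (2023), §1, §5. [GuillodSverak2023]
-/

open scoped Topology

namespace Literature.Analysis.OperatorTheory

variable {𝕜 X : Type*} [NontriviallyNormedField 𝕜] [NormedAddCommGroup X] [NormedSpace 𝕜 X]

/-- The fixed subspace `{x | R x = x}` of a continuous linear map `R` (the `R`-symmetric vectors),
as the kernel of `R − 1`. [folklore] -/
def fixedSubspace (R : X →L[𝕜] X) : Submodule 𝕜 X := LinearMap.ker ((R : X →ₗ[𝕜] X) - LinearMap.id)

/-- Membership in the fixed subspace: `x ∈ fixedSubspace R ↔ R x = x`. [folklore] -/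
theorem mem_fixedSubspace {R : X →L[𝕜] X} {x : X} : x ∈ fixedSubspace R ↔ R x = x := by
  simp [fixedSubspace, sub_eq_zero]

/-- The fixed subspace of a continuous linear map is closed. [folklore] -/
theorem isClosed_fixedSubspace (R : X →L[𝕜] X) :
    IsClosed ((fixedSubspace R : Submodule 𝕜 X) : Set X) := by
  have : ((fixedSubspace R : Submodule 𝕜 X) : Set X) = {x | R x - x = 0} := by
    ext x; simp [mem_fixedSubspace, sub_eq_zero]
  rw [this]
  exact isClosed_eq (R.continuous.sub continuous_id) continuous_const

variable [CompleteSpace X]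

/-- **Fredholm alternative on the fixed subspace.** Let `K` be a compact operator commuting with a
continuous linear map `R`, and suppose the kernel of `T = 1 − K` is spanned by one vector `φ` with
`R φ = −φ` (an `R`-antisymmetric simple zero eigenvector of `T`). Then every `R`-symmetric `w` is in the
range of `T`: the condition "`w ∉ Range T`" is FALSE for such `w`. Characteristic `≠ 2` is needed (a vector
both symmetric and antisymmetric satisfies `2 x = 0`). Standard functional analysis; the abstract form of
Jia–Šverák 2015, §4, "important non-generic case" (reflection-symmetric pitchfork), cf. the module
docstring. [folklore] -/
theorem symmetric_mem_range_of_antisymmetric_kernel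
    (K R : X →L[𝕜] X) (hK : IsCompactOperator K) (hRK : ∀ x, K (R x) = R (K x))
    (φ : X) (hφ : R φ = -φ)
    (hker : ∀ x, x - K x = 0 → ∃ c : 𝕜, x = c • φ)
    (h2 : (2 : 𝕜) ≠ 0)
    (w : X) (hw : R w = w) : ∃ v, v - K v = w := by
  classical
  -- the symmetric subspace is invariant under K
  set V : Submodule 𝕜 X := fixedSubspace R with hV
  have hKV : ∀ v ∈ V, (K : X →ₗ[𝕜] X) v ∈ V := by
    intro v hv
    rw [mem_fixedSubspace] at hv ⊢
    show R (K v) = K v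
    rw [← hRK, hv]
  have hclosed : IsClosed ((V : Submodule 𝕜 X) : Set X) := isClosed_fixedSubspace R
  -- the restricted operator is compact
  have hKc : IsCompactOperator ((K : X →ₗ[𝕜] X).restrict hKV) := hK.restrict hKV hclosed
  haveI : CompleteSpace V := hclosed.completeSpace_coe
  -- package the restriction as a continuous linear map on V
  let K' : V →L[𝕜] V :=
    { toLinearMap := (K : X →ₗ[𝕜] X).restrict hKV
      cont := by
        have : Continuous fun v : V => (K v : X) := K.continuous.comp continuous_subtype_val
        exact Continuous.subtype_mk this _ }
  have hK'c : IsCompactOperator K' := hKc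
  -- Fredholm alternative at μ = 1
  rcases hK'c.hasEigenvalue_or_mem_resolventSet (μ := (1 : 𝕜)) one_ne_zero with h | h
  · -- an eigenvector of K' with eigenvalue 1 would be a symmetric kernel vector of T: impossible
    exfalso
    obtain ⟨x, hx⟩ := h.exists_hasEigenvector
    have hx0 : x ≠ 0 := hx.2
    have hxK : K' x = x := by simpa using hx.apply_eq_smul
    have hxV : R (x : X) = x := (mem_fixedSubspace).1 x.2
    have hker' : (x : X) - K x = 0 := by
      have := congrArg Subtype.val hxK
      simp [K'] at this
      rw [this]; simp
    obtain ⟨c, hc⟩ := hker _ hker'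
    -- R x = x and R x = -x force 2 c • φ = 0 hence x = 0
    have hRx : R (x : X) = -(x : X) := by rw [hc, map_smul, hφ, smul_neg]
    have h2x : (2 : 𝕜) • (x : X) = 0 := by
      have hxx : (x : X) = -(x : X) := hxV.symm.trans hRx
      rw [two_smul]
      calc (x : X) + x = x + -x := by rw [← hxx]
        _ = 0 := add_neg_cancel _
    have : (x : X) = 0 := by
      have := congrArg (fun y => (2 : 𝕜)⁻¹ • y) h2x
      simpa [smul_smul, inv_mul_cancel₀ h2] using this
    exact hx0 (Subtype.ext this)
  · -- 1 ∈ resolvent set: 1 - K' is bijective on V, so w = (1 - K') v for some v ∈ V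
    rw [spectrum.mem_resolventSet_iff] at h
    have hbij : Function.Bijective (algebraMap 𝕜 (V →L[𝕜] V) 1 - K') :=
      (ContinuousLinearMap.isUnit_iff_bijective).1 h
    obtain ⟨v, hv⟩ := hbij.2 ⟨w, (mem_fixedSubspace).2 hw⟩
    refine ⟨v, ?_⟩
    have := congrArg Subtype.val hv
    simpa [K'] using this

end Literature.Analysis.OperatorTheory
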